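import Summits.HubbardSuperconductivity.HubbardSuperconductivity.Theorems.BalabanIRBirEveryGroundStateLogic

/-!
# SUMMIT-STRENGTH CERTIFICATE — crux `BirEveryGroundState` (stmt-HubbardSuperconductivity-2083), route BalabanIR

crux-strategist r1 (planner-cstrat-stmt-HubbardSuperconductivity-2083-r1-0, REDIRECT second opinion,
2026-08-17). Companion of `STRATEGY-CENSUS.md` Part R1 §R0 ("the theorem that makes the crux
summit-strength, so the tribunal can close it"). Kernel-checked, sorry-free, no new Literature fact,
no definition proposed to the tree: the `def`s below are verbatim fragments of the route decls
(`birEveryGroundState_iff_forall_cruxAt` and `birGroundStateAverageLRO_iff_exists_windowAvg` are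
`Iff.rfl`).

## What is certified (T1 shape of docs/architecture/tribunal.md)

Write `Avg_d` for the window-average body of the route's TARGET `BirGroundStateAverageLRO` at a datum
`d = (δ, U₁, U₂, c)` (`WindowAvg`), `S_d` for "the summit's matrix holds at SOME coupling of the window
`(U₁, U₂)` at doping `δ`" (`WindowSummit`), and `C_d := Avg_d → S_d` (`CruxAt`). Then:

* `birEveryGroundState_iff_forall_cruxAt` — the crux IS `∀ d admissible, C_d` (definitional).
* `cruxAt_iff_not_windowAvg_or_windowSummit` — EVERY INSTANCE of the crux is either VACUOUS
  (`¬ Avg_d`: the target fails at `d`) or THE SUMMIT ON THE WINDOW (`S_d`). There is no third kind of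
  content. `not_cruxAt_iff`: a refutation of any instance is a proof of the target at `d` together
  with a refutation of the summit on that window.
* `windowSummit_imp_summit`, `summit_iff_exists_windowSummit` — `S_d ⇒ HubbardSuperconductivity`
  for every admissible `d`, and the summit is `∃ d, S_d`: the window summit is the summit, located.
* T1 DOMINATING HYPOTHESIS, per datum: `H_d := S_d` satisfies `H_d ⇒ C_d` (`cruxAt_of_windowSummit`)
  and `H_d ⇒ S` alone (`windowSummit_imp_summit`); and at the datum the route CONSUMES (the one
  produced by `h4R h2R h3` in `Theses.BalabanIR.closes`), `Avg_d` is in hand and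
  `C_d ↔ S_d` (`cruxAt_iff_windowSummit_of_windowAvg`) — the consumed content of crux 5 is the summit
  on the engine's window, undiluted (`summit_of_windowAvg_of_cruxAt` is `closes` at one datum).
* T1 DOMINATING HYPOTHESIS for the ∀-law as typed: `DenseEvery` (every-ground-state `d`-wave LRO at a
  dense set of couplings for every doping) satisfies `DenseEvery ⇒ crux` and `DenseEvery ⇒ S`
  (`denseEvery_imp_birEveryGroundState`, `denseEvery_imp_summit`; = Disproof §1 over these names),
  and the crux with its hypothesis discharged is `DenseEvery` (`birEveryGroundState_iff_denseEvery_of`).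
* BRIDGE CLASSIFICATION (BC2 bridge rule): the route's X-split is `{T, B}` with `T` = target,
  `B` = crux, `T ∧ B → S` (`Assembly_holds`), and `B ↔ ∀ d, (T_d → S_d)` — `B` is the bridge
  "target ⇒ summit, window by window" (`birEveryGroundState_iff_forall_target_imp_windowSummit`).
  Whether the bridge has content SHORT of `S_d` once `T_d` is supplied is exactly what the three
  censuses (p1, s1, r1) deny: model-free it is false (`Disproof.not_abstractDarkPartnerExclusion`),
  hypothesis-free it is `DenseEvery ⊋ S` (`denseEvery_imp_summit`), and the conjugate-source re-cut
  targets are `↔ S` (`Theorems.hubbardSuperconductivity_iff_shiftedAverage`, p158616).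
* §S (Strengthen, census R1): `reverseMarkov` — the one regime in which average ⇒ every is FREE:
  `d` values in `[0, C]` with mean `≥ c` are all `≥ d·c − (d−1)·C`, positive iff `c/C > 1 − 1/d`
  (bounded ground degeneracy `d ≤ d₀` and `c > C_Y(δ)(1 − 1/d₀)`); the route consumes the crux at the
  engine's exponentially small `c`, outside this regime.
* §D (Decomposition, census R1 D9): `BddDegSubwindowLaw`, `CruxUnderBudget` typed and the glue
  `birEveryGroundState_of_bddDeg_of_cruxUnderBudget` PROVED; not filed (`--split`) because piece 2 keeps
  the crux's residual (dark direction under a budget) and piece 1 is a source-less per-`L` spectral law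
  — BC2 (d) "a plan for both sides" fails; recorded so the tribunal sees the best typed split.

Sources: classical propositional logic (drinker / material implication); Scalapino, Phys. Rep. 250
(1995) §2 eq. (2.4) for the order functional; the route file `Theses/BalabanIR.lean` rev 11 (`closes`).
-/

set_option linter.dupNamespace false

noncomputable section

namespace Summit.HubbardSuperconductivity.HubbardSuperconductivity.Cruxes.BirEveryGroundState.SummitStrength

open Matrix Finset Filter
open Literature.Probability.LatticeModels Literature.MathematicalPhysics.QuantumLattice
open Summit.HubbardSuperconductivity.HubbardSuperconductivity.Theorems
open Summit.HubbardSuperconductivity.HubbardSuperconductivity.Theses.BalabanIR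
open scoped ComplexOrder

/-! ## §0 The pieces of the crux, verbatim -/

/-- The target's body at ONE coupling: eventually in even `L`, `c·L⁴·Re tr P ≤ Re tr (P Δ_d†Δ_d)` with
`P` the projection onto the sector ground eigenspace (the `let`-block of the route decls, verbatim).
[folklore] -/
def AvgAt (δ U c : ℝ) : Prop :=
  ∃ L₀ : ℕ, ∀ (L : ℕ) [NeZero L], L₀ ≤ L → Even L →
    let N : ℕ := 2 * ⌊(1 - δ) * (L : ℝ) ^ 2 / 2⌋₊
    let H := hubbardTorus 2 L 1 U
    let S := szSector (Λ := FermionTorus 2 L) N 0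
    let E₀ := S ⊓ Module.End.eigenspace (Matrix.toLin' H) ((H.minEnergyOn S : ℝ) : ℂ)
    let P := projMatrix (E₀.map (Fock.toEuclidean (ι := Orb (FermionTorus 2 L)) :
      Fock (Orb (FermionTorus 2 L)) →ₗ[ℂ] EuclideanSpace ℂ (Finset (Orb (FermionTorus 2 L)))))
    c * (L : ℝ) ^ 4 * P.trace.re ≤
      (P * (Matrix.conjTranspose (pairField dWaveFormFactor L) * pairField dWaveFormFactor L)).trace.re

/-- `Avg_d`: the window-average hypothesis of the crux at the datum `d = (δ, U₁, U₂, c)` = the body of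
the target `BirGroundStateAverageLRO` at `d`. [folklore] -/
def WindowAvg (δ U₁ U₂ c : ℝ) : Prop :=
  ∀ U ∈ Set.Ioo U₁ U₂, AvgAt δ U c

/-- The summit's matrix at one coupling and doping (`HasDWavePairFieldLROAt U δ`, verbatim body):
EVERY admissible normalised sector ground-state sequence has `d_{x²-y²}` pair-field LRO. [folklore] -/
def EveryAt (U δ : ℝ) : Prop :=
  ∀ (N : ℕ → ℕ) (ψ : ∀ L, Fock (Orb (FermionTorus 2 L))),
    (∀ L, Even L → N L = 2 * ⌊(1 - δ) * (L : ℝ) ^ 2 / 2⌋₊ ∧ star (ψ L) ⬝ᵥ ψ L = 1 ∧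
      IsGroundStateInSector (hubbardTorus 2 L 1 U) (N L) 0 (ψ L)) →
    HasLongRangeOrder (fun k => halfOpenBox 2 (2 * k))
      (fun k => torusPullback (pairFieldCorr dWaveFormFactor ψ) (2 * k))

/-- `S_d`: THE SUMMIT ON THE WINDOW — the summit's matrix holds at SOME coupling of `(U₁, U₂)` at
doping `δ`. [folklore] -/
def WindowSummit (δ U₁ U₂ : ℝ) : Prop :=
  ∃ U ∈ Set.Ioo U₁ U₂, EveryAt U δ

/-- `C_d := Avg_d → S_d`: the crux at ONE datum. [folklore] -/
def CruxAt (δ U₁ U₂ c : ℝ) : Prop :=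
  WindowAvg δ U₁ U₂ c → WindowSummit δ U₁ U₂

/-- A datum `(δ, U₁, U₂, c)` is admissible when it lies in the crux's quantifier range. [folklore] -/
def Admissible (δ U₁ U₂ c : ℝ) : Prop :=
  δ ∈ Set.Ioo (0:ℝ) (1/2) ∧ 0 < U₁ ∧ U₁ < U₂ ∧ 0 < c

/-! ## §1 The crux and the target over these names (definitional) -/

/-- **The crux IS `∀ d admissible, C_d`.** [folklore] -/
theorem birEveryGroundState_iff_forall_cruxAt :
    BirEveryGroundState ↔
      ∀ (δ U₁ U₂ c : ℝ), δ ∈ Set.Ioo (0:ℝ) (1/2) → 0 < U₁ → U₁ < U₂ → 0 < c → CruxAt δ U₁ U₂ c :=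
  Iff.rfl

/-- **The target IS `∃ d admissible, Avg_d`.** [folklore] -/
theorem birGroundStateAverageLRO_iff_exists_windowAvg :
    BirGroundStateAverageLRO ↔
      ∃ δ ∈ Set.Ioo (0:ℝ) (1/2), ∃ U₁ U₂ c : ℝ, 0 < U₁ ∧ U₁ < U₂ ∧ 0 < c ∧ WindowAvg δ U₁ U₂ c :=
  Iff.rfl

/-- Same, with the admissibility predicate bundled. [folklore] -/
theorem birEveryGroundState_iff_forall_admissible :
    BirEveryGroundState ↔ ∀ (δ U₁ U₂ c : ℝ), Admissible δ U₁ U₂ c → CruxAt δ U₁ U₂ c := by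
  rw [birEveryGroundState_iff_forall_cruxAt]
  exact ⟨fun h δ U₁ U₂ c hd => h δ U₁ U₂ c hd.1 hd.2.1 hd.2.2.1 hd.2.2.2,
    fun h δ U₁ U₂ c hδ hU₁ hU₁₂ hc => h δ U₁ U₂ c ⟨hδ, hU₁, hU₁₂, hc⟩⟩

/-! ## §2 The window summit is the summit, located -/

/-- **`S_d ⇒ S`** for every window inside the repulsive half-line and every admissible doping.
[folklore] -/
theorem windowSummit_imp_summit {δ U₁ U₂ : ℝ} (hδ : δ ∈ Set.Ioo (0:ℝ) (1/2)) (hU₁ : 0 ≤ U₁)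
    (h : WindowSummit δ U₁ U₂) : _root_.HubbardSuperconductivity := by
  obtain ⟨U, hU, hE⟩ := h
  show Literature.Hubbard.DWaveSuperconductivityHubbard
  exact ⟨U, lt_of_le_of_lt hU₁ hU.1, δ, hδ, hE⟩

/-- **The summit is a located window summit**: `S ↔ ∃ δ ∈ (0,1/2), ∃ 0 < U₁ < U₂, S_(δ,U₁,U₂)`.
(→: around the summit's coupling `U` take the window `(U/2, 2U)`.) [folklore] -/
theorem summit_iff_exists_windowSummit :
    _root_.HubbardSuperconductivity ↔
      ∃ δ ∈ Set.Ioo (0:ℝ) (1/2), ∃ U₁ U₂ : ℝ, 0 < U₁ ∧ U₁ < U₂ ∧ WindowSummit δ U₁ U₂ := by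
  constructor
  · intro h
    obtain ⟨U, hU, δ, hδ, hE⟩ := HubbardSuperconductivity_iff.1 h
    refine ⟨δ, hδ, U / 2, 2 * U, by positivity, by linarith, U, ⟨by linarith, by linarith⟩, ?_⟩
    exact hE
  · rintro ⟨δ, hδ, U₁, U₂, hU₁, -, hW⟩
    exact windowSummit_imp_summit hδ hU₁.le hW

/-! ## §3 Every instance of the crux is vacuous or the summit on its window -/

/-- **T1 dominating hypothesis, per datum: `H_d := S_d ⇒ C_d`** (and `H_d ⇒ S` is
`windowSummit_imp_summit`). [folklore] -/
theorem cruxAt_of_windowSummit {δ U₁ U₂ : ℝ} (c : ℝ) (h : WindowSummit δ U₁ U₂) :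
    CruxAt δ U₁ U₂ c :=
  fun _ => h

/-- **Vacuous instances**: if the target fails at `d`, the crux holds at `d`. [folklore] -/
theorem cruxAt_of_not_windowAvg {δ U₁ U₂ c : ℝ} (h : ¬ WindowAvg δ U₁ U₂ c) : CruxAt δ U₁ U₂ c :=
  fun hA => absurd hA h

/-- **NORMAL FORM: every instance of the crux is either VACUOUS or THE SUMMIT ON ITS WINDOW.**
[folklore] -/
theorem cruxAt_iff_not_windowAvg_or_windowSummit {δ U₁ U₂ c : ℝ} :
    CruxAt δ U₁ U₂ c ↔ (¬ WindowAvg δ U₁ U₂ c ∨ WindowSummit δ U₁ U₂) :=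
  imp_iff_not_or

/-- **A refutation of any instance = a proof of the target at `d` AND a refutation of the summit on
that window.** [folklore] -/
theorem not_cruxAt_iff {δ U₁ U₂ c : ℝ} :
    ¬ CruxAt δ U₁ U₂ c ↔ (WindowAvg δ U₁ U₂ c ∧ ¬ WindowSummit δ U₁ U₂) :=
  Classical.not_imp

/-- **THE CONSUMED INSTANCE IS THE SUMMIT ON THE WINDOW.** Once `Avg_d` is in hand (as in
`Theses.BalabanIR.closes`, where it is `h4R h2R h3` at the engine's datum), `C_d ↔ S_d`. [folklore] -/
theorem cruxAt_iff_windowSummit_of_windowAvg {δ U₁ U₂ c : ℝ} (hA : WindowAvg δ U₁ U₂ c) :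
    CruxAt δ U₁ U₂ c ↔ WindowSummit δ U₁ U₂ :=
  ⟨fun h => h hA, fun h _ => h⟩

/-- **`closes` at one datum**: target body at an admissible `d` + the crux's instance at `d` ⇒ summit.
This is all the route ever extracts from crux 5. [folklore] -/
theorem summit_of_windowAvg_of_cruxAt {δ U₁ U₂ c : ℝ} (hδ : δ ∈ Set.Ioo (0:ℝ) (1/2))
    (hU₁ : 0 < U₁) (hA : WindowAvg δ U₁ U₂ c) (hC : CruxAt δ U₁ U₂ c) :
    _root_.HubbardSuperconductivity :=
  windowSummit_imp_summit hδ hU₁.le (hC hA)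

/-- **The route's deciding theorem uses exactly one instance of the crux** (re-derivation of
`Theses.BalabanIR.closes` through `summit_of_windowAvg_of_cruxAt`; the ∀ over all other data is
never consumed). [folklore] -/
theorem closes_via_one_instance (h2R : BirComplexStableXYR) (h3 : BirBdGPhaseCoercivity)
    (h4R : BirGappedPhaseReductionR)
    (hT : ∀ (δ U₁ U₂ c : ℝ), Admissible δ U₁ U₂ c → CruxAt δ U₁ U₂ c) :
    _root_.HubbardSuperconductivity := by
  obtain ⟨δ, hδ, U₁, U₂, c, hU₁, hU₁₂, hc, hA⟩ :=
    birGroundStateAverageLRO_iff_exists_windowAvg.1 (h4R h2R h3)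
  exact summit_of_windowAvg_of_cruxAt hδ hU₁ hA (hT δ U₁ U₂ c ⟨hδ, hU₁, hU₁₂, hc⟩)

/-! ## §4 The bridge classification and the dominating hypothesis of the ∀-law -/

/-- **The crux is the bridge "target ⇒ summit, window by window".** [folklore] -/
theorem birEveryGroundState_iff_forall_target_imp_windowSummit :
    BirEveryGroundState ↔
      ∀ (δ U₁ U₂ c : ℝ), Admissible δ U₁ U₂ c → WindowAvg δ U₁ U₂ c → WindowSummit δ U₁ U₂ :=
  birEveryGroundState_iff_forall_admissible

/-- `DenseEvery`: every-ground-state `d`-wave LRO at a DENSE set of repulsive couplings (one in every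
window) for EVERY doping `δ ∈ (0, 1/2)` — the crux with its hypothesis discharged (`= Disproof.DenseEveryGS`
over these names). [folklore] -/
def DenseEvery : Prop :=
  ∀ δ ∈ Set.Ioo (0:ℝ) (1/2), ∀ U₁ U₂ : ℝ, 0 < U₁ → U₁ < U₂ → WindowSummit δ U₁ U₂

/-- **T1 dominating hypothesis of the ∀-law: `DenseEvery ⇒ crux`.** [folklore] -/
theorem denseEvery_imp_birEveryGroundState (h : DenseEvery) : BirEveryGroundState :=
  birEveryGroundState_iff_forall_cruxAt.2 fun δ U₁ U₂ c hδ hU₁ hU₁₂ _ =>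
    cruxAt_of_windowSummit c (h δ hδ U₁ U₂ hU₁ hU₁₂)

/-- **… and `DenseEvery ⇒ S` alone** (`δ = 1/4`, window `(1, 2)`). [folklore] -/
theorem denseEvery_imp_summit (h : DenseEvery) : _root_.HubbardSuperconductivity :=
  windowSummit_imp_summit (δ := 1/4) (U₁ := 1) (U₂ := 2) ⟨by norm_num, by norm_num⟩ zero_le_one
    (h (1/4) ⟨by norm_num, by norm_num⟩ 1 2 one_pos one_lt_two)

/-- **If the target's body held at every admissible datum, the crux would BE `DenseEvery`** (so the
hypothesis is load-bearing only through WHERE the target fails — the regime map of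
`Theorems.birEveryGroundState_iff_onRegimeMap` — never through what it says where it holds).
[folklore] -/
theorem birEveryGroundState_iff_denseEvery_of
    (hAll : ∀ (δ U₁ U₂ c : ℝ), Admissible δ U₁ U₂ c → WindowAvg δ U₁ U₂ c) :
    BirEveryGroundState ↔ DenseEvery := by
  refine ⟨fun h δ hδ U₁ U₂ hU₁ hU₁₂ => ?_, denseEvery_imp_birEveryGroundState⟩
  exact (birEveryGroundState_iff_forall_admissible.1 h) δ U₁ U₂ 1 ⟨hδ, hU₁, hU₁₂, one_pos⟩
    (hAll δ U₁ U₂ 1 ⟨hδ, hU₁, hU₁₂, one_pos⟩)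

/-- **The X-split of the route as a bridge split `{T, T ⇒_windows S}`**: `T ∧ B → S` with `T` the
target and `B` the crux (`Assembly_holds`), restated over the located window summit. [folklore] -/
theorem assembly_as_bridge :
    BirGroundStateAverageLRO → BirEveryGroundState → _root_.HubbardSuperconductivity :=
  fun hT hB => Assembly_holds ⟨hT, hB⟩

/-- **Insulation, both directions, over these names** (= `Theorems.birEveryGroundState_of_not_…` /
`…_of_not_birEveryGroundState`): the crux fails only at a datum where the target HOLDS and the summit
FAILS on the window. [folklore] -/
theorem not_birEveryGroundState_iff :
    ¬ BirEveryGroundState ↔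
      ∃ (δ U₁ U₂ c : ℝ), Admissible δ U₁ U₂ c ∧ WindowAvg δ U₁ U₂ c ∧ ¬ WindowSummit δ U₁ U₂ := by
  rw [birEveryGroundState_iff_forall_admissible]
  push Not
  constructor
  · rintro ⟨δ, U₁, U₂, c, hd, hC⟩
    exact ⟨δ, U₁, U₂, c, hd, not_cruxAt_iff.1 hC⟩
  · rintro ⟨δ, U₁, U₂, c, hd, hA, hS⟩
    exact ⟨δ, U₁, U₂, c, hd, not_cruxAt_iff.2 ⟨hA, hS⟩⟩

/-! ## §S Strengthen (census R1): the one regime where average ⇒ every is free -/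

/-- **Reverse-Markov inequality.** If `d` real numbers are each `≤ C` and their sum is `≥ d·c`, then
each is `≥ d·c − (d−1)·C`. Applied to the eigenvalues of the compression of `L⁻⁴Δ_d†Δ_d` to a ground
eigenspace of dimension `d ≤ d₀` (each `≤ C_Y(δ)`, Yang; mean `≥ c`, the hypothesis): every ground
state is bright as soon as `c > C_Y(δ)·(1 − 1/d₀)`. This is the only hypothesis-FED average ⇒ every
mechanism found by any census; the route consumes the crux at the engine's `c`, which is exponentially
small in `1/U²` at weak coupling, i.e. outside this regime for every `d₀ ≥ 2`. [folklore] -/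
theorem reverseMarkov {d : ℕ} (lam : Fin d → ℝ) (C c : ℝ) (hle : ∀ i, lam i ≤ C)
    (havg : (d : ℝ) * c ≤ ∑ i, lam i) (i : Fin d) :
    (d : ℝ) * c - ((d : ℝ) - 1) * C ≤ lam i := by
  have hsplit : ∑ j, lam j = lam i + ∑ j ∈ Finset.univ.erase i, lam j :=
    (Finset.add_sum_erase _ _ (Finset.mem_univ i)).symm
  have hcard : ((Finset.univ.erase i).card : ℝ) = (d : ℝ) - 1 := by
    rw [Finset.card_erase_of_mem (Finset.mem_univ i), Finset.card_univ, Fintype.card_fin,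
      Nat.cast_pred (Fin.pos i)]
  have hrest : ∑ j ∈ Finset.univ.erase i, lam j ≤ ((d : ℝ) - 1) * C := by
    calc ∑ j ∈ Finset.univ.erase i, lam j ≤ ∑ j ∈ Finset.univ.erase i, C :=
          Finset.sum_le_sum fun j _ => hle j
      _ = ((Finset.univ.erase i).card : ℝ) * C := by rw [Finset.sum_const, nsmul_eq_mul]
      _ = ((d : ℝ) - 1) * C := by rw [hcard]
  linarith

/-- The threshold form: under the same hypotheses with `C·(1 − 1/d) < c` (and `C ≥ 0`), every value is
positive. [folklore] -/
theorem reverseMarkov_pos {d : ℕ} (lam : Fin d → ℝ) (C c : ℝ) (hle : ∀ i, lam i ≤ C)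
    (havg : (d : ℝ) * c ≤ ∑ i, lam i) (hthr : C * (1 - 1 / (d : ℝ)) < c) (i : Fin d) :
    0 < lam i := by
  have hd : (0 : ℝ) < d := by exact_mod_cast Fin.pos i
  have h := reverseMarkov lam C c hle havg i
  have hmul : (d : ℝ) * (C * (1 - 1 / (d : ℝ))) < (d : ℝ) * c := mul_lt_mul_of_pos_left hthr hd
  have hexp : (d : ℝ) * (C * (1 - 1 / (d : ℝ))) = ((d : ℝ) - 1) * C := by
    field_simp
  linarith

/-! ## §D Decomposition (census R1, D9): the best typed split, glue proved, NOT filed -/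

/-- Ground degeneracy at `(δ, U, L)`: the dimension of the sector ground eigenspace. [folklore] -/
def groundDim (δ U : ℝ) (L : ℕ) [NeZero L] : ℕ :=
  let N : ℕ := 2 * ⌊(1 - δ) * (L : ℝ) ^ 2 / 2⌋₊
  let H := hubbardTorus 2 L 1 U
  let S := szSector (Λ := FermionTorus 2 L) N 0
  Module.finrank ℂ ↥(S ⊓ Module.End.eigenspace (Matrix.toLin' H) ((H.minEnergyOn S : ℝ) : ℂ))

/-- Eventually (in even `L`) bounded ground degeneracy at one coupling. [folklore] -/
def BddDegAt (δ U : ℝ) (d₀ : ℕ) : Prop :=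
  ∃ L₀ : ℕ, ∀ (L : ℕ) [NeZero L], L₀ ≤ L → Even L → groundDim δ U L ≤ d₀

/-- Piece 1 (hypothesis-free, kind (A) in its weakest form): every repulsive window contains a
SUB-WINDOW on which the ground degeneracy of the doped sector is eventually bounded by one `d₀`.
Source-less for doped repulsive Hubbard tori (no per-`L` spectral tool uniform in `L`); plausible;
realised with `d₀ = 3` at the anomalous `L = 4` (Disproof §4). [folklore] -/
def BddDegSubwindowLaw : Prop :=
  ∀ δ ∈ Set.Ioo (0:ℝ) (1/2), ∀ U₁ U₂ : ℝ, 0 < U₁ → U₁ < U₂ →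
    ∃ V₁ V₂ : ℝ, U₁ ≤ V₁ ∧ V₁ < V₂ ∧ V₂ ≤ U₂ ∧ ∃ d₀ : ℕ, ∀ U ∈ Set.Ioo V₁ V₂, BddDegAt δ U d₀

/-- Piece 2 (the crux under a degeneracy budget): window average AND bounded degeneracy at every
coupling of the window ⇒ the summit on the window. For `c > C_Y(δ)(1 − 1/d₀)` it is `reverseMarkov`;
below that threshold — where the route lives — its residual is the crux's (exclude a dark direction in a
ground eigenspace of dimension `≤ d₀`: Samuelson-sharp, census Part B D2, `Disproof` §2 has `d = 2`).
[folklore] -/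
def CruxUnderBudget : Prop :=
  ∀ (δ U₁ U₂ c : ℝ) (d₀ : ℕ), δ ∈ Set.Ioo (0:ℝ) (1/2) → 0 < U₁ → U₁ < U₂ → 0 < c →
    (∀ U ∈ Set.Ioo U₁ U₂, AvgAt δ U c ∧ BddDegAt δ U d₀) → WindowSummit δ U₁ U₂

/-- **Glue of D9, proved**: `BddDegSubwindowLaw → CruxUnderBudget → BirEveryGroundState` (shrink the
window to the budgeted sub-window, where the average hypothesis persists; a coupling found there lies in
the original window). Typed and checked so that the census's verdict "not an admissible `--split`"
rests on BC2 (d) (no plan for either piece), not on a failure to assemble. [folklore] -/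
theorem birEveryGroundState_of_bddDeg_of_cruxUnderBudget (h₁ : BddDegSubwindowLaw)
    (h₂ : CruxUnderBudget) : BirEveryGroundState := by
  rw [birEveryGroundState_iff_forall_cruxAt]
  intro δ U₁ U₂ c hδ hU₁ hU₁₂ hc hA
  obtain ⟨V₁, V₂, hUV₁, hV₁₂, hVU₂, d₀, hB⟩ := h₁ δ hδ U₁ U₂ hU₁ hU₁₂
  have hsub : Set.Ioo V₁ V₂ ⊆ Set.Ioo U₁ U₂ := Set.Ioo_subset_Ioo hUV₁ hVU₂
  obtain ⟨U, hU, hE⟩ := h₂ δ V₁ V₂ c d₀ hδ (lt_of_lt_of_le hU₁ hUV₁) hV₁₂ hc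
    (fun U hU => ⟨hA U (hsub hU), hB U hU⟩)
  exact ⟨U, hsub hU, hE⟩

/-! ## §N Negation (census R1, N9): a `D`-annihilated dark partner freezes the ground energy forever -/

/-- **Flat once, flat forever.** A concave, nondecreasing function on `[0, ∞)` that is constant on a
non-trivial interval `[U₁, U₂]` is constant on the whole half-line `[U₁, ∞)`. DICTIONARY (census R1
§Negation N9): `f U = E_S(T + U·D)`, the sector ground energy of the affine pencil, is concave (a minimum
of affine functions of `U`) and nondecreasing (`D = Σ n↑n↓ ≥ 0`); a permanently degenerate DARK partner
annihilated by `D` — the `S = N/2` (Nagaoka) multiplet, or any doublon-free eigenvector of `T` — has a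
`U`-INDEPENDENT energy, so its degeneracy with the ground branch on a window `[U₁, U₂]` makes `f`
constant there, hence constant on `[U₁, ∞)`: that partner is a ground state at EVERY larger coupling
and every ground state there is doublon-free (`⟨D⟩ = f' = 0`). So this enemy is equivalent to
saturated-ferromagnet / doublon-free ground states of the doped torus on a half-line of couplings,
cofinitely in `L` — an open Nagaoka-stability problem, not a usable stub. [folklore] -/
theorem flat_forever {f : ℝ → ℝ} (hf : ConcaveOn ℝ (Set.Ici 0) f) (hmono : MonotoneOn f (Set.Ici 0))
    {U₁ U₂ : ℝ} (hU₁ : 0 ≤ U₁) (hU₁₂ : U₁ < U₂) (hflat : f U₁ = f U₂) :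
    ∀ x, U₂ ≤ x → f x = f U₁ := by
  intro x hx
  rcases eq_or_lt_of_le hx with rfl | hlt
  · exact hflat.symm
  have hU₂ : (0 : ℝ) ≤ U₂ := by linarith
  have hx0 : (0 : ℝ) ≤ x := by linarith
  -- concavity: the slope on `[U₂, x]` is at most the slope on `[U₁, U₂]`, which is `0`
  have hslope := hf.slope_anti_adjacent (Set.mem_Ici.2 hU₁) (Set.mem_Ici.2 hx0) hU₁₂ hlt
  have hzero : (f U₂ - f U₁) / (U₂ - U₁) = 0 := by rw [hflat, sub_self, zero_div]
  rw [hzero] at hslope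
  have hle : f x - f U₂ ≤ 0 := by
    have hpos : 0 < x - U₂ := sub_pos.2 hlt
    have := (div_le_iff₀ hpos).1 hslope
    simpa using this
  have hge : f U₂ ≤ f x := hmono (Set.mem_Ici.2 hU₂) (Set.mem_Ici.2 hx0) hx
  linarith

end Summit.HubbardSuperconductivity.HubbardSuperconductivity.Cruxes.BirEveryGroundState.SummitStrength
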